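import Summits.MatrixMultiplication.MatrixMultiplication.Theorems.AbelianSTPPCensusTD2StatSound
import Summits.MatrixMultiplication.MatrixMultiplication.Theorems.AbelianSTPPCensusTD2StatDom
import Summits.MatrixMultiplication.MatrixMultiplication.Theorems.AbelianSTPPCensusTD2StatCk1
import Summits.MatrixMultiplication.MatrixMultiplication.Theorems.AbelianSTPPCensusTD2StatCk2
import Summits.MatrixMultiplication.MatrixMultiplication.Theorems.AbelianSTPPCensusTD2StatCk3
import Summits.MatrixMultiplication.MatrixMultiplication.Theorems.AbelianSTPPCensusLeafTD627Closed

/-!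
# T_D/667: no abelian STPP host of order `≤ 667` beats `τ = 2.47` (static t*-indexed certificate with the k-member bucket-descent tree)

Cell mm-stpp (rung F-M1), tier T_D = «beat `2.47`, i.e. every abelian STPP construction of the CKSU era» (CENSUS-PLAN §2); successor kernel item of the closed crux
item stmt-MatrixMultiplication-19191, seat mm-stpp-vp-p2 (gen 5); second T_D range after `AbelianSTPPCensusLeafTD627Closed.lean` (gen 4).  For every finite abelian group `H`
with `|H| ≤ 667` and every STPP family `(A_i,B_i,C_i)` in `H`: `Σ_i (|A_i||B_i||C_i|)^(2.47/3) ≤ |H|`, stated on `NoAbelianSTPPHostUpTo (247/100) 667`.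
Assembly: `|H| ≤ 627` by `noAbelianSTPPHostUpTo_247_627` (same exponent); `628 … 667` by `AbelianTECensus.sieveSound`, `u11GSound_holds`, `TAKnap575.e3Adm_of_isSTPP`
and the arithmetic exclusion `TD2Stat.not_beats_247` — theory g11/g12's static t*-indexed linear certificate (`AbelianSTPPCensusTD2Stat{Defs,Rows,Rows2,Sound}.lean`,
table and bucket lists `…TD2StatData1/…TD2StatData`, gains `…TD2GainTable247`) whose one-member relaxation ends at `627 – 629` for T_D, extended past that wall by
INTEGRALITY on the bucket structure: the k-member bucket-descent tree `TAStatKM` (`AbelianSTPPCensusTAStatKMember.lean`, `…KMemberSound.lean`; at most 8 explicit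
members per node, exact per order), kernel-evaluated in `…TD2StatDom` / `…TD2StatCk1–3` (`decide +kernel`, standard axioms, no `native_decide`; 2709 sorted candidate
shapes, 82288 (shape, bucket) cells of which 35 go through the tree, 22146 tree nodes) and tiled here (`dom_all`, `ck_all`, `m2_all`).  `667` is the
end of this hypothesis set for T_D: at order `668` the list `(7,7,8)⁴ + (7,7,7)` passes vM ∪ U11-G ∪ E3 and beats `2.47` (exact twin seat calc/twomember/tastat7.py; the
registered instrument vQ = vP ∧ E3⁺ stays alive from `681` at the latest, `vqpCensusTD_false_above_680`).
Census reading: the T_D KERNEL column moves `627 → 667`; no instrument number of the cell is touched.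
WHAT THIS IS NOT: no bound on `ω`; rung-leaf class (a finite range of a necessary condition); no existence claim (in particular none for the order-`668` list);
nothing about orders `≥ 668`, about non-abelian hosts, or about the columns at `2.4`, `2.375`, `2.371` and `5/2`.
-/

set_option linter.dupNamespace false -- `MatrixMultiplication.MatrixMultiplication` (summit = problem, D-0017)
set_option autoImplicit false

namespace Summit.MatrixMultiplication.MatrixMultiplication.Theorems

namespace TD2Stat

open ShapeCert (gainOfTDY D)
open TD2StatData (nl nb)

/-- **The certificate excludes beating.** Under the hypotheses of `sum_gain_le`: `¬ Beats (247/100) M`. [original] -/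
theorem not_beats_of_cert (hmono : monoOK nl nb = true)
    (hdom : ∀ V, 1 ≤ V → V ≤ 667 → ∀ x ∈ triplesS V, domX V (gainOfTDY V) x = true)
    (hck : ∀ V, 1 ≤ V → V ≤ 667 → ∀ x ∈ triplesS V, checkShape V (gainOfTDY V) x = true)
    (hm2 : ∀ V, 1 ≤ V → V ≤ 667 → ∀ x ∈ triplesS V, m2f (bucketOf (x.1 * x.2.1)) = true → x ∈ m2l (bucketOf (x.1 * x.2.1)))
    {N M : ℕ} {a b c : Fin N → ℕ} (hN : 2 ≤ N) (hlo : 628 ≤ M) (hM : M ≤ 667)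
    (hS : SieveAdmissible M a b c) (hG : U11G M a b c) (hE : TAKnap575.E3Adm M a b c) : ¬ Beats (247 / 100) M a b c := by
  have hsum := sum_gain_le hmono hdom hck hm2 hN hlo hM hS hG hE
  have hV : ∀ i, a i * b i * c i ≤ 667 := fun i => by
    have := (hS.1 i).2.2.2; simp only [shapeVol] at this; omega
  unfold Beats
  simp only [shapeVol, not_lt]
  have hle : ∑ i, ((a i * b i * c i : ℕ) : ℝ) ^ ((247 / 100 : ℝ) / 3) ≤
      ∑ i, (gainOfTDY (a i * b i * c i) : ℝ) / 1000000 :=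
    Finset.sum_le_sum fun i _ => ShapeCert.rpow_le_gainTDY _ (hV i)
  rw [← Finset.sum_div] at hle
  refine hle.trans ?_
  rw [div_le_iff₀ (by norm_num)]
  have h2 : ((∑ i, gainOfTDY (a i * b i * c i) : ℕ) : ℝ) ≤ ((D * M : ℕ) : ℝ) := by exact_mod_cast hsum
  push_cast at h2
  simpa [D, mul_comm] using h2

/-- every sorted candidate shape of every volume `1 … 667` is dominated by the table (the `dom*` kernel chunks, tiled) -/
theorem dom_all : ∀ V, 1 ≤ V → V ≤ 667 → ∀ x ∈ triplesS V, domX V (gainOfTDY V) x = true := by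
  intro V h1 h2
  by_cases c1 : V ≤ 226
  · exact domV_sound _ _ dom1 V (by omega) (by omega)
  by_cases c227 : V ≤ 408
  · exact domV_sound _ _ dom227 V (by omega) (by omega)
  exact domV_sound _ _ dom409 V (by omega) (by omega)

/-- every sorted candidate shape of every volume `1 … 667` passes `checkShape` (the `ck*` kernel chunks, tiled) -/
theorem ck_all : ∀ V, 1 ≤ V → V ≤ 667 → ∀ x ∈ triplesS V, checkShape V (gainOfTDY V) x = true := by
  intro V h1 h2
  by_cases c1 : V ≤ 232
  · exact checkV_sound _ _ ck1 V (by omega) (by omega)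
  by_cases c233 : V ≤ 332
  · exact checkV_sound _ _ ck233 V (by omega) (by omega)
  by_cases c333 : V ≤ 392
  · exact checkV_sound _ _ ck333 V (by omega) (by omega)
  by_cases c393 : V ≤ 468
  · exact checkV_sound _ _ ck393 V (by omega) (by omega)
  by_cases c469 : V ≤ 560
  · exact checkV_sound _ _ ck469 V (by omega) (by omega)
  exact checkV_sound _ _ ck561 V (by omega) (by omega)

/-- the bucket lists are complete (the `m2c*` kernel chunks, tiled) -/
theorem m2_all : ∀ V, 1 ≤ V → V ≤ 667 → ∀ x ∈ triplesS V, m2f (bucketOf (x.1 * x.2.1)) = true → x ∈ m2l (bucketOf (x.1 * x.2.1)) := by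
  intro V h1 h2
  by_cases c1 : V ≤ 312
  · exact m2V_sound _ _ m2c1 V (by omega) (by omega)
  exact m2V_sound _ _ m2c313 V (by omega) (by omega)

/-- **T_D arithmetic exclusion, orders `628 … 667`.** No shape list with at least two members that is `SieveAdmissible M`, `U11G M` and
`TAKnap575.E3Adm M` beats `τ = 247/100` at an order `628 ≤ M ≤ 667`. [original] -/
theorem not_beats_247 (N M : ℕ) (a b c : Fin N → ℕ) (hN : 2 ≤ N) (h1 : 628 ≤ M) (h2 : M ≤ 667)
    (hS : SieveAdmissible M a b c) (hG : U11G M a b c) (hE : TAKnap575.E3Adm M a b c) : ¬ Beats (247 / 100) M a b c :=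
  not_beats_of_cert mono_ok dom_all ck_all m2_all hN h1 h2 hS hG hE

end TD2Stat

/-- **T_D/667.** No abelian STPP host of order `≤ 667` beats the exponent `2.47`: `Σ_i (|A_i||B_i||C_i|)^(2.47/3) ≤ |H|` for every STPP family in every
finite abelian group `H` with `|H| ≤ 667`.  Orders `≤ 627`: `noAbelianSTPPHostUpTo_247_627` (vp-p2 g4); orders `628 … 667`: `AbelianTECensus.sieveSound`,
`u11GSound_holds`, `TAKnap575.e3Adm_of_isSTPP` and `TD2Stat.not_beats_247` (static certificate + k-member bucket-descent tree).
WHAT THIS IS NOT: no bound on `ω`; rung-leaf class; nothing about orders `≥ 668` or non-abelian hosts. [original] -/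
theorem noAbelianSTPPHostUpTo_247_667 : NoAbelianSTPPHostUpTo (247 / 100) 667 := by
  classical
  refine AbelianTECensus.noAbelianSTPPHostUpTo_of_two (τ := 247 / 100) (by norm_num) (by norm_num) ?_
  intro H _ _ hM N A B C hS hne hN
  by_cases h627 : Fintype.card H ≤ 627
  · exact noAbelianSTPPHostUpTo_247_627 H h627 N A B C hS
  · have hadm := AbelianTECensus.sieveSound H N A B C hS hne
    have hG := u11GSound_holds H N A B C hS hne
    have he3 := TAKnap575.e3Adm_of_isSTPP hS hne
    have h := TD2Stat.not_beats_247 N (Fintype.card H) _ _ _ hN (by omega) hM hadm hG he3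
    unfold Beats at h
    rw [not_lt] at h
    simpa [shapeVol] using h

end Summit.MatrixMultiplication.MatrixMultiplication.Theorems
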